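import Mathlib
import HarnessLib

/-!
# Function-field mirror: the ANGLE-TWIN and POWER-TWIN identities of the window tower
(pub-rhpf, seat ffmirror-2; HONEST FRAMING: mechanism/rigidity campaign — no RH claims)

The function-field wing of the Weil observatory (pub-weilobs `FF.md` §1) attaches to a Weil-shaped
datum `(q, P)`, `P(T) = ∏_{j=1}^{2g} (1 - α_j T)` (equivalently the characteristic polynomial of
Frobenius `h(x) = ∏_j (x - α_j) = x^{2g} P(1/x)`), the WINDOW FORMS
`T_M = (K(|m - m'|))_{0 ≤ m, m' ≤ M}`, `K(n) = s_n / (2 q^{n/2})`, `s_n = Σ_j α_j ^ n` (so `K(0) = g`),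
one symmetric Toeplitz matrix per degree window `M`; the number-field window `λ` corresponds to
`a = M log q / 2`.  Every admissible spectral / eigenvector / nodal / M2-tier reader of the cell's
invariant harness is a functional of the tower `M ↦ T_M`.

This file states the form over the multiset `A` of Frobenius roots and proves two identities
(pure algebra, [folklore]):

* ANGLE-TWIN LEMMA `ffWindowForm_eq_of_twin`: if two data have the same NORMALISED root multiset,
  `A.map (· / √q) = A'.map (· / √q')` (the same Frobenius-angle multiset when `|α_j| = √q`), then
  `T_M(q, A) = T_M(q', A')` for every `M`; hence every functional of the whole tower agrees on the two
  data (`towerFunctional_eq_of_twin`).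
* POWER-TWIN LEMMA `ffWindowForm_nsmul` / `weilWindowForm_pow`: replacing `h` by `h ^ E` at the SAME
  `q` multiplies every `T_M` by `E`; hence every functional of the tower that is invariant under
  positive scaling agrees on `(q, h)` and `(q, h ^ E)` (`scaleInvariant_eq_of_pow`).

What is deliberately NOT here (cited arithmetic, THEOREM in print, not formalised): whether `(q, h)`
is the characteristic polynomial of Frobenius of an abelian variety over `F_q` (Honda–Tate;
Waterhouse 1969 Thm 4.1 for `g = 1`, Howe–Nart–Ritzenthaler for `g = 2`) is decided by `p`-adic
data of `(q, h)` and takes BOTH values on angle twins — e.g. `(q, t) = (4, 2)` (realizable) and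
`(49, 7)` (not realizable) share the normalised polynomial `z² - z + 1` (worked instance below) —
while for EVERY `q`-Weil polynomial `h` some power `h ^ E` is realizable at the same `q`
(Honda–Tate existence; `E` = lcm of the exponents `e_π`).  Consequence recorded in the cell's door
ledger (E-MOT, RULING A100): no functional of the window tower reads geometric origin; the DATA
(12,674 served census windows, 59 candidates of record) is in HOME/pub-rhpf-ffmirror-2/SEPARATION.md.
-/

set_option linter.dupNamespace false  -- the mandated namespace repeats `RiemannHypothesis`

noncomputable section

open Polynomial

namespace Summit.RiemannHypothesis.RiemannHypothesis.Theorems.PfPersistence.FfAngleTwin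

/-! ## The window tower of a root multiset -/

/-- Power sum `s_n(A) = Σ_{α ∈ A} α ^ n` of a multiset of complex numbers (with multiplicity). [folklore] -/
def powerSum (A : Multiset ℂ) (n : ℕ) : ℂ := (A.map fun α => α ^ n).sum

/-- The normalised root multiset `A / √q` — for a `q`-Weil datum (`|α| = √q`) this is the multiset of
unimodular numbers `e^{i φ_j}`, i.e. the Frobenius-ANGLE data. [folklore] -/
def normRoots (q : ℝ) (A : Multiset ℂ) : Multiset ℂ := A.map fun α => α / (Real.sqrt q : ℂ)

/-- The Toeplitz symbol of the function-field window form (pub-weilobs FF.md §1):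
`K(n) = s_n / (2 q^{n/2}) = (1/2) Σ_j (α_j/√q)^n`; in particular `K(0) = (#A)/2 = g`. [folklore] -/
def ffKernel (q : ℝ) (A : Multiset ℂ) (n : ℕ) : ℂ := powerSum (normRoots q A) n / 2

/-- The window form `T_M(q, A) = (K(|m - m'|))_{0 ≤ m, m' ≤ M}` of the degree window `M`
(a symmetric Toeplitz matrix of size `M + 1`). [folklore] -/
def ffWindowForm (q : ℝ) (A : Multiset ℂ) (M : ℕ) : Matrix (Fin (M + 1)) (Fin (M + 1)) ℂ :=
  Matrix.of fun m m' => ffKernel q A (Nat.dist m m')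

/-- The type of window towers: one matrix of size `M + 1` per degree window `M`. [folklore] -/
abbrev Tower : Type := (M : ℕ) → Matrix (Fin (M + 1)) (Fin (M + 1)) ℂ

/-- The window TOWER `M ↦ T_M(q, A)` of a datum. [folklore] -/
def ffWindowTower (q : ℝ) (A : Multiset ℂ) : Tower := fun M => ffWindowForm q A M

/-- Positive scaling of a whole tower, `(c • T)_M = c · T_M`. [folklore] -/
def Tower.scale (c : ℝ) (T : Tower) : Tower := fun M => (c : ℂ) • T M

/-! A functional `Φ` of towers is SCALE-INVARIANT if it cannot see a common positive factor —
`∀ c > 0, ∀ T, Φ (Tower.scale c T) = Φ T` (normalised eigenvectors, sign patterns, nodal counts, eigenvalue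
ratios, M2-type ratios, …); below this is always an explicit hypothesis `hΦ`, never a named `Prop`. -/

/-! ## Elementary identities -/

/-- `s_0(A) = #A`. [folklore] -/
theorem powerSum_zero (A : Multiset ℂ) : powerSum A 0 = (Multiset.card A : ℂ) := by
  simp [powerSum]

/-- `#(A/√q) = #A`. [folklore] -/
theorem card_normRoots (q : ℝ) (A : Multiset ℂ) : Multiset.card (normRoots q A) = Multiset.card A := by
  simp [normRoots]

/-- `K(0) = (#A)/2` (`= g` for a Weil datum of dimension `g`, `#A = 2g`). [folklore] -/
theorem ffKernel_zero (q : ℝ) (A : Multiset ℂ) : ffKernel q A 0 = (Multiset.card A : ℂ) / 2 := by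
  simp [ffKernel, powerSum_zero, card_normRoots]

/-- The served formula: `K(n) = s_n(A) / (2 (√q)^n)`. [folklore] -/
theorem ffKernel_eq (q : ℝ) (A : Multiset ℂ) (n : ℕ) :
    ffKernel q A n = powerSum A n / (2 * (Real.sqrt q : ℂ) ^ n) := by
  unfold ffKernel powerSum normRoots
  rw [Multiset.map_map]
  have : ((fun α : ℂ => α ^ n) ∘ fun α : ℂ => α / (Real.sqrt q : ℂ)) =
      fun α : ℂ => α ^ n * ((Real.sqrt q : ℂ) ^ n)⁻¹ := by
    funext α; simp only [Function.comp_apply]; rw [div_pow, div_eq_mul_inv]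
  rw [this, Multiset.sum_map_mul_right]
  ring

/-- Power sums are additive under multiset scaling: `s_n(E • A) = E · s_n(A)`. [folklore] -/
theorem powerSum_nsmul (E : ℕ) (A : Multiset ℂ) (n : ℕ) : powerSum (E • A) n = (E : ℂ) * powerSum A n := by
  simp [powerSum, Multiset.map_nsmul, Multiset.sum_nsmul, nsmul_eq_mul]

/-- `(E • A)/√q = E • (A/√q)`. [folklore] -/
theorem normRoots_nsmul (q : ℝ) (E : ℕ) (A : Multiset ℂ) : normRoots q (E • A) = E • normRoots q A := by
  simp [normRoots, Multiset.map_nsmul]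

/-! ## The angle-twin lemma -/

/-- ANGLE-TWIN LEMMA (symbol level): equal normalised root multisets ⇒ equal Toeplitz symbols `K(n)`
for every `n`. [folklore] -/
theorem ffKernel_eq_of_twin {q q' : ℝ} {A A' : Multiset ℂ} (h : normRoots q A = normRoots q' A') (n : ℕ) :
    ffKernel q A n = ffKernel q' A' n := by
  simp [ffKernel, h]

/-- ANGLE-TWIN LEMMA: two data `(q, A)`, `(q', A')` with the same normalised root multiset (the same
Frobenius-angle multiset) have IDENTICAL window forms `T_M` for every degree window `M`. [folklore] -/
theorem ffWindowForm_eq_of_twin {q q' : ℝ} {A A' : Multiset ℂ} (h : normRoots q A = normRoots q' A') (M : ℕ) :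
    ffWindowForm q A M = ffWindowForm q' A' M := by
  ext m m'
  simp [ffWindowForm, ffKernel_eq_of_twin h]

/-- … hence identical window TOWERS. [folklore] -/
theorem ffWindowTower_eq_of_twin {q q' : ℝ} {A A' : Multiset ℂ} (h : normRoots q A = normRoots q' A') :
    ffWindowTower q A = ffWindowTower q' A' := by
  funext M; exact ffWindowForm_eq_of_twin h M

/-- CONSEQUENCE: every functional of the window tower — any depth, any number of windows, any value
type — takes the same value on angle twins.  (Realizability / geometric origin is not such a functional:
it differs across twins, by Honda–Tate — cited, not formalised.) [folklore] -/
theorem towerFunctional_eq_of_twin {β : Sort*} (Φ : Tower → β) {q q' : ℝ} {A A' : Multiset ℂ}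
    (h : normRoots q A = normRoots q' A') : Φ (ffWindowTower q A) = Φ (ffWindowTower q' A') := by
  rw [ffWindowTower_eq_of_twin h]

/-! ## The power-twin lemma (same `q`) -/

/-- POWER-TWIN LEMMA (multiset level): `T_M(q, E • A) = E · T_M(q, A)` for every `M`. [folklore] -/
theorem ffWindowForm_nsmul (q : ℝ) (E : ℕ) (A : Multiset ℂ) (M : ℕ) :
    ffWindowForm q (E • A) M = ((E : ℝ) : ℂ) • ffWindowForm q A M := by
  ext m m'
  simp [ffWindowForm, ffKernel, normRoots_nsmul, powerSum_nsmul, mul_div_assoc]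

/-- … i.e. the tower of `(q, E • A)` is the `E`-scaled tower of `(q, A)`. [folklore] -/
theorem ffWindowTower_nsmul (q : ℝ) (E : ℕ) (A : Multiset ℂ) :
    ffWindowTower q (E • A) = Tower.scale (E : ℝ) (ffWindowTower q A) := by
  funext M; exact ffWindowForm_nsmul q E A M

/-- CONSEQUENCE: every SCALE-INVARIANT functional of the tower takes the same value on `(q, A)` and on
its power twin `(q, E • A)`, `E ≥ 1` — at the same constant field, hence the same `a = M log q / 2`. [folklore] -/
theorem scaleInvariant_eq_of_nsmul {β : Sort*} {Φ : Tower → β}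
    (hΦ : ∀ (c : ℝ), 0 < c → ∀ T : Tower, Φ (Tower.scale c T) = Φ T) (q : ℝ) {E : ℕ}
    (hE : 0 < E) (A : Multiset ℂ) : Φ (ffWindowTower q (E • A)) = Φ (ffWindowTower q A) := by
  rw [ffWindowTower_nsmul]
  exact hΦ (E : ℝ) (by exact_mod_cast hE) _

/-! ## Dictionary with integer polynomials (characteristic polynomial of Frobenius) -/

/-- The complex root multiset of an integer polynomial; for the characteristic polynomial of Frobenius
`h(x) = ∏_j (x - α_j) = x^{2g} P(1/x)` of a Weil datum these are the reciprocal roots `α_j` of the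
`L`-polynomial `P`. [folklore] -/
def frobRoots (h : ℤ[X]) : Multiset ℂ := (h.map (Int.castRingHom ℂ)).roots

/-- The window form of the datum `(q, h)`. [folklore] -/
def weilWindowForm (q : ℝ) (h : ℤ[X]) (M : ℕ) : Matrix (Fin (M + 1)) (Fin (M + 1)) ℂ :=
  ffWindowForm q (frobRoots h) M

/-- The window tower of the datum `(q, h)`. [folklore] -/
def weilWindowTower (q : ℝ) (h : ℤ[X]) : Tower := ffWindowTower q (frobRoots h)

/-- Roots of a power: `roots(h^E) = E • roots(h)`. [folklore] -/
theorem frobRoots_pow (h : ℤ[X]) (E : ℕ) : frobRoots (h ^ E) = E • frobRoots h := by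
  simp [frobRoots, Polynomial.map_pow, Polynomial.roots_pow]

/-- POWER-TWIN LEMMA (polynomial level): `T_M(q, h^E) = E · T_M(q, h)` for every `M`. [folklore] -/
theorem weilWindowForm_pow (q : ℝ) (h : ℤ[X]) (E M : ℕ) :
    weilWindowForm q (h ^ E) M = ((E : ℝ) : ℂ) • weilWindowForm q h M := by
  simp [weilWindowForm, frobRoots_pow, ffWindowForm_nsmul]

/-- CONSEQUENCE: a scale-invariant tower functional cannot distinguish `(q, h)` from `(q, h^E)`, `E ≥ 1`.
With Honda–Tate existence (cited): every honest function-field fake has, at the SAME `q`, a genuine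
power twin invisible to all such readers. [folklore] -/
theorem scaleInvariant_eq_of_pow {β : Sort*} {Φ : Tower → β}
    (hΦ : ∀ (c : ℝ), 0 < c → ∀ T : Tower, Φ (Tower.scale c T) = Φ T) (q : ℝ) (h : ℤ[X])
    {E : ℕ} (hE : 0 < E) : Φ (weilWindowTower q (h ^ E)) = Φ (weilWindowTower q h) := by
  unfold weilWindowTower
  rw [frobRoots_pow]
  exact scaleInvariant_eq_of_nsmul hΦ q hE _

/-- ANGLE-TWIN LEMMA (polynomial level): data `(q, h)`, `(q', h')` whose normalised root multisets agree
have identical towers, hence agree under every tower functional. [folklore] -/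
theorem weilTowerFunctional_eq_of_twin {β : Sort*} (Φ : Tower → β) {q q' : ℝ} {h h' : ℤ[X]}
    (htwin : normRoots q (frobRoots h) = normRoots q' (frobRoots h')) :
    Φ (weilWindowTower q h) = Φ (weilWindowTower q' h') :=
  towerFunctional_eq_of_twin Φ htwin

/-! ## Worked instance: `(q, t) = (4, 2)` vs `(49, 7)` (SEPARATION.md §2)

`h = x² - 2x + 4` (`q = 4`; realizable: the elliptic curve class 1.4.ac) and `h' = x² - 7x + 49`
(`q = 49`; NOT realizable, Waterhouse Thm 4.1: `t = √q`, `p = 7 ≡ 1 mod 3`) have roots `1 ± i√3` and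
`(7 ± 7 i √3)/2`; both normalise to `e^{± iπ/3}`.  We check the root property and the twin identity on
the explicit root multisets (the identification with `Polynomial.roots` is not needed for the door). -/

/-- the two roots of `x² - 2x + 4`. [folklore] -/
def rootsQ4 : Multiset ℂ := {1 + (Real.sqrt 3 : ℂ) * Complex.I, 1 - (Real.sqrt 3 : ℂ) * Complex.I}

/-- the two roots of `x² - 7x + 49`. [folklore] -/
def rootsQ49 : Multiset ℂ :=
  {(7 + 7 * (Real.sqrt 3 : ℂ) * Complex.I) / 2, (7 - 7 * (Real.sqrt 3 : ℂ) * Complex.I) / 2}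

/-- `1 ± i√3` are roots of `x² - 2x + 4`. [folklore] -/
theorem rootsQ4_isRoot : ∀ z ∈ rootsQ4, z ^ 2 - 2 * z + 4 = 0 := by
  have h3 : ((Real.sqrt 3 : ℂ)) ^ 2 = 3 := by
    rw [← Complex.ofReal_pow, Real.sq_sqrt (by norm_num : (0:ℝ) ≤ 3)]; norm_num
  intro z hz
  simp only [rootsQ4, Multiset.insert_eq_cons, Multiset.mem_cons, Multiset.mem_singleton] at hz
  rcases hz with rfl | rfl
  · linear_combination Complex.I ^ 2 * h3 + 3 * Complex.I_sq
  · linear_combination Complex.I ^ 2 * h3 + 3 * Complex.I_sq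

/-- `(7 ± 7i√3)/2` are roots of `x² - 7x + 49`. [folklore] -/
theorem rootsQ49_isRoot : ∀ z ∈ rootsQ49, z ^ 2 - 7 * z + 49 = 0 := by
  have h3 : ((Real.sqrt 3 : ℂ)) ^ 2 = 3 := by
    rw [← Complex.ofReal_pow, Real.sq_sqrt (by norm_num : (0:ℝ) ≤ 3)]; norm_num
  intro z hz
  simp only [rootsQ49, Multiset.insert_eq_cons, Multiset.mem_cons, Multiset.mem_singleton] at hz
  rcases hz with rfl | rfl
  · linear_combination (49 / 4 : ℂ) * Complex.I ^ 2 * h3 + (147 / 4 : ℂ) * Complex.I_sq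
  · linear_combination (49 / 4 : ℂ) * Complex.I ^ 2 * h3 + (147 / 4 : ℂ) * Complex.I_sq

/-- The two data are ANGLE TWINS: `rootsQ4 / √4 = rootsQ49 / √49` (both `= {e^{iπ/3}, e^{-iπ/3}}`). [folklore] -/
theorem twin_4_49 : normRoots 4 rootsQ4 = normRoots 49 rootsQ49 := by
  have h4 : (Real.sqrt 4 : ℂ) = 2 := by
    rw [show (4 : ℝ) = 2 ^ 2 by norm_num, Real.sqrt_sq (by norm_num : (0:ℝ) ≤ 2)]; norm_num
  have h49 : (Real.sqrt 49 : ℂ) = 7 := by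
    rw [show (49 : ℝ) = 7 ^ 2 by norm_num, Real.sqrt_sq (by norm_num : (0:ℝ) ≤ 7)]; norm_num
  simp only [normRoots, rootsQ4, rootsQ49, Multiset.insert_eq_cons, Multiset.map_cons,
    Multiset.map_singleton, h4, h49]
  congr 1
  · ring
  · congr 1; ring

/-- … so their window forms coincide at every degree window although one datum is geometric and the
other is not (Waterhouse; cited). [folklore] -/
theorem windowForm_4_49 (M : ℕ) : ffWindowForm 4 rootsQ4 M = ffWindowForm 49 rootsQ49 M :=
  ffWindowForm_eq_of_twin twin_4_49 M

end Summit.RiemannHypothesis.RiemannHypothesis.Theorems.PfPersistence.FfAngleTwin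

end
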